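import Literature.Analysis.FluidPDE.PassiveVectorEnergyEquality
import Literature.Analysis.FluidPDE.PassiveVectorDissipationBound
import Literature.Analysis.ODE.IntegralGronwall
import Summits.AnomalousDissipation.AnomalousDissipation.Theorems.SolenoidalFractalHomogenisationLagrangianStepDualityTools
import HarnessLib

/-!
# K3′ `K3NonlinearClosure` (aside, stmt-AnomalousDissipation-20027), line `Localised` — helper for STUB S2c
`stub_halfPulseEnergyBound`: the ν-UNIFORM weak-class energy inequality with production

For the weak class `Torus.IsWeakPassiveVectorOn A T ν b w₀ w` (`∂ₜw + (b·∇)w + A (w·∇)b + ∇π = νΔw`,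
`∇·w = 0`, `w ∈ L^∞_t L²_x`, tested against smooth divergence-free fields; Yoshida–Kaneda 2000 (4)–(5))
with `ν > 0`, a bounded carrier and an `L²` weakly divergence-free datum we prove, WITHOUT any weak-class
uniqueness or existence statement, the energy inequality with the production bounded through the
STRAIN of the carrier (not through `‖b‖_∞²/ν`):

* if for a.e. `s` and every smooth divergence-free `v`, `A ∫⟪b(s), (v·∇)v⟫ ≤ Λ(s) ∫‖v‖²` (`Λ ≥ 0`
  continuous), then for a.e. `t ∈ (0,T)`
  `∫‖w(t)‖² ≤ ∫‖w₀‖² + 2 ∫_{(0,t]} Λ(s) ∫‖w(s)‖² ds` (`ae_integral_norm_sq_le_add`) and hence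
  `∫‖w(t)‖² ≤ (∫‖w₀‖²) · exp (∫₀ᵗ 2Λ)` (`ae_integral_norm_sq_le_mul_exp`, Grönwall–Bellman run on the
  continuous majorant `t ↦ ∫‖w₀‖² + 2∫₀ᵗ Λ‖w‖²`).

Mechanism (Robinson–Rodrigo–Sadowski 2016, §4.2 (4.20), run on the weak solution itself as in the tree's
`PassiveVectorEnergyEquality`): the Galerkin identity `‖P_N w(t)‖² = ‖P_N w₀‖² + 2∫₀ᵗ Φ[w; P_N w]`
(`IsWeakPassiveVectorOn.ae_galerkin_energy_eq`, every `A`), the transport flux rewritten as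
`∫⟪w − P_N w, (b·∇)P_N w⟫ − ν‖∇P_N w‖²`, the STRETCHING flux split as
`A∫⟪b, ((w − P_N w)·∇)P_N w⟫ + A∫⟪b, (P_N w·∇)P_N w⟫` — the first is a tail term like the transport
remainder (`≤ d M ‖w − P_N w‖₂ ‖∇P_N w‖₂`, summable against the finite dissipation of the class,
`PassiveVectorDissipationBound`), the second is CLASSICAL (the truncation `P_N w(s)` is a smooth
divergence-free trigonometric polynomial) and is where the production hypothesis enters — then `N → ∞`
(Parseval tails → 0 in `L¹(0,T)`, dominated convergence) and Grönwall (`Literature.Analysis.ODE.gronwall_integral_le_on`).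
This is the tool that makes the K3′ line's `HalfPulseEnergyBound` (crude operator bound `e^{γ}` per half
pulse, uniformly in `ν`, for the WEAK `A = 1` class) provable.
-/

-- `Summit.<Summit>.<Problem>`: single-conjunct summit, the duplicate namespace segment is deliberate.
set_option linter.dupNamespace false

noncomputable section

open MeasureTheory Set Filter Function TopologicalSpace
open scoped ENNReal NNReal InnerProductSpace Topology
open Literature.Analysis Literature.Analysis.FluidPDE Literature.Analysis.FluidPDE.Torus

namespace Summit.AnomalousDissipation.AnomalousDissipation.Theorems.SawtoothPulseCascade.K3NonlinearClosureLocalised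

variable {d : Type*} [Fintype d] [DecidableEq d]

/-- **The stretching pairing against a smooth field is controlled by the dissipation** (twin of the tree's
`Torus.abs_integral_inner_convect_le_of_norm_le` with the bounded field in the OTHER slot): if `‖u‖ ≤ M`
a.e. and `v ∈ L²`, then `|∫⟪u, (v·∇)Ψ⟫| ≤ d · M · (∫‖v‖²)^{1/2} · (gradNormSq Ψ)^{1/2}`
(`‖(v·∇)Ψ‖ ≤ ‖v‖ ∑ⱼ‖∂ⱼΨ‖`, Cauchy–Schwarz). [cite: RobinsonRodrigoSadowski2016, §4.2 (energy estimate)] -/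
theorem abs_integral_inner_convect_le_of_norm_le_left {u v : UnitAddTorus d → EuclideanSpace ℝ d}
    (hv : MemLp v 2 volume) {M : ℝ} (hM : 0 ≤ M)
    (huM : ∀ᵐ x ∂volume, ‖u x‖ ≤ M)
    {Ψ : UnitAddTorus d → EuclideanSpace ℝ d} (hΨ : FunctionSpaces.Torus.IsSmooth Ψ) :
    |∫ x, ⟪u x, FunctionSpaces.Torus.convect v Ψ x⟫_ℝ| ≤
      Fintype.card d * M * Real.sqrt (∫ x, ‖v x‖ ^ 2) * Real.sqrt (FunctionSpaces.Torus.gradNormSq Ψ) := by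
  have h1 : FunctionSpaces.Torus.IsContDiff 1 Ψ := hΨ.isContDiff (by simp)
  -- pointwise bound
  have hpt : ∀ᵐ x ∂volume, |⟪u x, FunctionSpaces.Torus.convect v Ψ x⟫_ℝ| ≤
      M * ∑ j, ‖v x‖ * ‖FunctionSpaces.Torus.partialDeriv j Ψ x‖ := by
    filter_upwards [huM] with x hx
    calc |⟪u x, FunctionSpaces.Torus.convect v Ψ x⟫_ℝ| ≤ ‖u x‖ * ‖FunctionSpaces.Torus.convect v Ψ x‖ :=
          abs_real_inner_le_norm _ _
      _ ≤ M * (‖v x‖ * ∑ j, ‖FunctionSpaces.Torus.partialDeriv j Ψ x‖) :=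
          mul_le_mul hx (FunctionSpaces.Torus.norm_convect_le v h1 x) (norm_nonneg _) hM
      _ = M * ∑ j, ‖v x‖ * ‖FunctionSpaces.Torus.partialDeriv j Ψ x‖ := by rw [Finset.mul_sum]
  have hint : ∀ j, Integrable (fun x => ‖v x‖ * ‖FunctionSpaces.Torus.partialDeriv j Ψ x‖) volume := by
    intro j
    obtain ⟨C, hC⟩ := (isCompact_univ.image (hΨ.partialDeriv j).continuous).isBounded.exists_norm_le
    have hC' : ∀ x, ‖FunctionSpaces.Torus.partialDeriv j Ψ x‖ ≤ C := fun x => hC _ ⟨x, mem_univ _, rfl⟩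
    exact ((hv.integrable one_le_two).norm.mul_const C).mono'
      (hv.1.norm.mul (hΨ.partialDeriv j).continuous.aestronglyMeasurable.norm)
      (ae_of_all _ fun x => by
        rw [Real.norm_eq_abs, abs_of_nonneg (mul_nonneg (norm_nonneg _) (norm_nonneg _))]
        exact mul_le_mul_of_nonneg_left (hC' x) (norm_nonneg _))
  have hgrad : ∀ j, ∫ x, ‖FunctionSpaces.Torus.partialDeriv j Ψ x‖ ^ 2 ≤ FunctionSpaces.Torus.gradNormSq Ψ := by
    intro j
    unfold FunctionSpaces.Torus.gradNormSq
    refine integral_mono_of_nonneg (ae_of_all _ fun x => sq_nonneg _) ?_ (ae_of_all _ fun x => ?_)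
    · exact (continuous_finsetSum _ fun i _ => ((hΨ.partialDeriv i).continuous.norm.pow 2)).integrable_of_hasCompactSupport
        (HasCompactSupport.of_compactSpace _)
    · exact Finset.single_le_sum (f := fun i => ‖FunctionSpaces.Torus.partialDeriv i Ψ x‖ ^ 2)
        (fun i _ => sq_nonneg _) (Finset.mem_univ j)
  calc |∫ x, ⟪u x, FunctionSpaces.Torus.convect v Ψ x⟫_ℝ|
      ≤ ∫ x, |⟪u x, FunctionSpaces.Torus.convect v Ψ x⟫_ℝ| := abs_integral_le_integral_abs
    _ ≤ ∫ x, M * ∑ j, ‖v x‖ * ‖FunctionSpaces.Torus.partialDeriv j Ψ x‖ :=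
        integral_mono_of_nonneg (ae_of_all _ fun x => abs_nonneg _)
          ((integrable_finsetSum _ fun j _ => hint j).const_mul M) hpt
    _ = M * ∑ j, ∫ x, ‖v x‖ * ‖FunctionSpaces.Torus.partialDeriv j Ψ x‖ := by
        rw [integral_const_mul, integral_finsetSum _ fun j _ => hint j]
    _ ≤ M * ∑ j : d, Real.sqrt (∫ x, ‖v x‖ ^ 2) * Real.sqrt (FunctionSpaces.Torus.gradNormSq Ψ) := by
        refine mul_le_mul_of_nonneg_left (Finset.sum_le_sum fun j _ => ?_) hM
        calc ∫ x, ‖v x‖ * ‖FunctionSpaces.Torus.partialDeriv j Ψ x‖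
            ≤ Real.sqrt (∫ x, ‖v x‖ ^ 2) * Real.sqrt (∫ x, ‖FunctionSpaces.Torus.partialDeriv j Ψ x‖ ^ 2) :=
              FunctionSpaces.Torus.integral_norm_mul_norm_le_sqrt_sq_mul_sqrt_sq hv
                ((hΨ.partialDeriv j).continuous.memLp_of_hasCompactSupport (HasCompactSupport.of_compactSpace _))
          _ ≤ Real.sqrt (∫ x, ‖v x‖ ^ 2) * Real.sqrt (FunctionSpaces.Torus.gradNormSq Ψ) :=
              mul_le_mul_of_nonneg_left (Real.sqrt_le_sqrt (hgrad j)) (Real.sqrt_nonneg _)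
    _ = Fintype.card d * M * Real.sqrt (∫ x, ‖v x‖ ^ 2) * Real.sqrt (FunctionSpaces.Torus.gradNormSq Ψ) := by
        rw [Finset.sum_const, Finset.card_univ, nsmul_eq_mul]
        ring



/-- **ν-uniform energy inequality with production for weak passive vectors (pre-Grönwall form).** Let
`w ∈ L^∞_t L²_x` be a weak solution of `∂ₜw + (b·∇)w + A (w·∇)b + ∇π = νΔw`, `∇·w = 0` on `T^d × [0,T)`
(`IsWeakPassiveVectorOn A T ν b w₀ w`) with `ν > 0`, `stLift b ∈ L^∞((0,T) × T^d)` and an `L²` weakly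
divergence-free datum `w₀`; assume the PRODUCTION BOUND: for a.e. `s ∈ (0,T)` and every smooth
divergence-free `v`, `A ∫⟪b(s), (v·∇)v⟫ ≤ Λ(s) ∫‖v‖²` with `Λ ≥ 0` continuous. Then for a.e. `t ∈ (0,T)`
`∫‖w(t)‖² ≤ ∫‖w₀‖² + 2∫_{(0,t]} Λ(s) ∫‖w(s)‖² ds` — the viscosity enters only through the finiteness of
the dissipation, never in the constant (Galerkin identity on the weak solution, RRS 2016 (4.20); the
stretching flux against the own truncation is classical up to a Parseval tail).
[cite: RobinsonRodrigoSadowski2016, §4.2 (4.20)] [cite: MajdaBertozziCUP2002, §3.1.1 Prop. 3.1 (3.7) (energy growth by the velocity-gradient rate)] -/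
theorem ae_integral_norm_sq_le_add {A T ν : ℝ} {b w : ℝ → UnitAddTorus d → EuclideanSpace ℝ d}
    {w₀ : UnitAddTorus d → EuclideanSpace ℝ d}
    (h : IsWeakPassiveVectorOn A T ν b w₀ w) (hν : 0 < ν)
    (hw₀ : MemLp w₀ 2 volume) (hdiv₀ : FunctionSpaces.Torus.IsWeaklyDivFree w₀)
    (hb : MemLp (FunctionSpaces.Torus.stLift b) ∞ (volume.restrict (Ioo 0 T ×ˢ univ)))
    {Λ : ℝ → ℝ} (hΛc : Continuous Λ) (hΛ0 : ∀ s, 0 ≤ Λ s)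
    (hprod : ∀ᵐ s ∂(volume.restrict (Ioo 0 T)), ∀ v : UnitAddTorus d → EuclideanSpace ℝ d,
      FunctionSpaces.Torus.IsSmooth v → FunctionSpaces.Torus.IsDivFree v →
      A * ∫ x, ⟪b s x, FunctionSpaces.Torus.convect v v x⟫_ℝ ≤ Λ s * ∫ x, ‖v x‖ ^ 2) :
    ∀ᵐ t ∂(volume.restrict (Ioo 0 T)),
      ∫ x, ‖w t x‖ ^ 2 ≤ (∫ x, ‖w₀ x‖ ^ 2) + 2 * ∫ s in Ioc 0 t, Λ s * ∫ x, ‖w s x‖ ^ 2 := by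
  classical
  obtain ⟨M, hM, hbM⟩ := ae_ae_norm_le_of_memLp_top_stLift hb
  -- ### finite dissipation of the class
  have hDT : eVectorDissipation ν w 0 T < ⊤ := h.eVectorDissipation_lt_top hν hw₀ hdiv₀ hb
  have hfin : ∫⁻ s in Ioo 0 T, FunctionSpaces.Torus.eGradNormSq (w s) < ⊤ := by
    unfold eVectorDissipation at hDT
    rcases ENNReal.mul_lt_top_iff.1 hDT with h1 | h1 | h1
    · exact h1.2
    · exact absurd (ENNReal.ofReal_eq_zero.1 h1) (not_le.2 hν)
    · rw [h1]; exact ENNReal.zero_lt_top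
  -- ### notation
  set P : ℕ → (UnitAddTorus d → EuclideanSpace ℝ d) → UnitAddTorus d → EuclideanSpace ℝ d :=
    fun N v => FunctionSpaces.Torus.fourierTruncate N v with hP
  set F : ℕ → ℝ → ℝ := fun N s =>
    (∫ x, ⟪w s x, FunctionSpaces.Torus.convect (b s) (P N (w s)) x + ν • FunctionSpaces.Torus.laplacian (P N (w s)) x⟫_ℝ) +
      A * ∫ x, ⟪b s x, FunctionSpaces.Torus.convect (w s) (P N (w s)) x⟫_ℝ with hF
  set D : ℕ → ℝ → ℝ := fun N s => (FunctionSpaces.Torus.eGradNormSq (P N (w s))).toReal with hD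
  set tail : ℕ → ℝ → ℝ := fun N s => ∫ x, ‖w s x - P N (w s) x‖ ^ 2 with htail
  set E : ℝ → ℝ := fun s => ∫ x, ‖w s x‖ ^ 2 with hE
  set C : ℝ := (1 + |A|) * (Fintype.card d * M) with hC
  have hC0 : 0 ≤ C := by positivity
  set G : ℕ → ℝ → ℝ := fun N s => C * (Real.sqrt (tail N s) * Real.sqrt (D N s)) with hG
  set g : ℝ → ℝ≥0∞ := fun s => FunctionSpaces.Torus.eGradNormSq (w s) with hg
  -- ### the truncated identity for a.e. `t` and all `N`
  have hId : ∀ᵐ t ∂(volume.restrict (Ioo 0 T)), ∀ N,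
      ∫ x, ⟪P N (w t) x, P N (w t) x⟫_ℝ = (∫ x, ⟪P N w₀ x, P N w₀ x⟫_ℝ) + 2 * ∫ s in Ioc 0 t, F N s :=
    ae_all_iff.2 fun N => h.ae_galerkin_energy_eq hw₀ hdiv₀ N
  -- ### integrability on `(0,T)`
  have hFint : ∀ N, IntegrableOn (F N) (Ioo 0 T) := fun N => h.integrableOn_galerkinFlux N
  have hDint : ∀ N, IntegrableOn (D N) (Ioo 0 T) ∧ ∫ s in Ioo 0 T, D N s ≤ (∫⁻ s in Ioo 0 T, g s).toReal :=
    fun N => h.integrableOn_toReal_eGradNormSq_fourierTruncate hfin N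
  obtain ⟨htailint, -, -⟩ := h.galerkin_tail
  have hEint : IntegrableOn E (Ioo 0 T) := h.integrableOn_integral_norm_sq
  have hΛE : IntegrableOn (fun s => Λ s * E s) (Ioo 0 T) :=
    hEint.continuousOn_mul_of_subset hΛc.continuousOn isCompact_Icc measurableSet_Ioo Ioo_subset_Icc_self
  have htail_nn : ∀ N s, 0 ≤ tail N s := fun N s => integral_nonneg fun x => sq_nonneg _
  have hD_nn : ∀ N s, 0 ≤ D N s := fun N s => ENNReal.toReal_nonneg
  have hG_nn : ∀ N s, 0 ≤ G N s := fun N s =>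
    mul_nonneg hC0 (mul_nonneg (Real.sqrt_nonneg _) (Real.sqrt_nonneg _))
  have hst : ∀ N, IntegrableOn (fun s => Real.sqrt (tail N s) * Real.sqrt (D N s)) (Ioo 0 T) := by
    intro N
    have hm : AEStronglyMeasurable (fun s => Real.sqrt (tail N s) * Real.sqrt (D N s)) (volume.restrict (Ioo 0 T)) :=
      (Real.continuous_sqrt.comp_aestronglyMeasurable (htailint N).aestronglyMeasurable).mul
        (Real.continuous_sqrt.comp_aestronglyMeasurable (hDint N).1.aestronglyMeasurable)
    refine Integrable.mono' (((htailint N).add (hDint N).1).div_const 2) hm (ae_of_all _ fun s => ?_)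
    show ‖Real.sqrt (tail N s) * Real.sqrt (D N s)‖ ≤ (tail N s + D N s) / 2
    rw [Real.norm_eq_abs, abs_of_nonneg (mul_nonneg (Real.sqrt_nonneg _) (Real.sqrt_nonneg _))]
    nlinarith [Real.sq_sqrt (htail_nn N s), Real.sq_sqrt (hD_nn N s),
      sq_nonneg (Real.sqrt (tail N s) - Real.sqrt (D N s))]
  have hGint : ∀ N, IntegrableOn (G N) (Ioo 0 T) := fun N => (hst N).const_mul C
  -- ### the flux against the own truncation: tail terms + production, a.e. in `s`
  have hFle : ∀ N, ∀ᵐ s ∂(volume.restrict (Ioo 0 T)), F N s ≤ G N s + Λ s * E s := by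
    intro N
    filter_upwards [h.ae_integrable_slice, h.ae_memLp_two, h.ae_isWeaklyDivFree_carrier, h.ae_isWeaklyDivFree,
      h.ae_aestronglyMeasurable_slice, hbM, hprod] with s hs hs2 hbdiv hwdiv hsm hbs hps
    have hbint : Integrable (b s) volume := Integrable.of_bound hsm.2 M hbs
    have hPs : FunctionSpaces.Torus.IsSmooth (P N (w s)) := FunctionSpaces.Torus.isSmooth_fourierTruncate N (w s)
    have hPdiv : FunctionSpaces.Torus.IsDivFree (P N (w s)) :=
      FunctionSpaces.Torus.isDivFree_fourierTruncate hs2 hwdiv N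
    have hP2 : MemLp (P N (w s)) 2 volume := FunctionSpaces.Torus.memLp_fourierTruncate N _ 2
    have hv : MemLp (fun x => w s x - P N (w s) x) 2 volume := hs2.sub hP2
    -- transport + Stokes
    have h1 : (∫ x, ⟪w s x, FunctionSpaces.Torus.convect (b s) (P N (w s)) x +
          ν • FunctionSpaces.Torus.laplacian (P N (w s)) x⟫_ℝ) =
        (∫ x, ⟪w s x - P N (w s) x, FunctionSpaces.Torus.convect (b s) (P N (w s)) x⟫_ℝ) - ν * D N s := by
      rw [hP, integral_inner_convect_add_smul_laplacian_fourierTruncate hs.1 hs.2.1 ν N,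
        integral_inner_convect_fourierTruncate_eq_remainder hbint hbdiv hs.2.1 N]
    have hR : |∫ x, ⟪w s x - P N (w s) x, FunctionSpaces.Torus.convect (b s) (P N (w s)) x⟫_ℝ| ≤
        Fintype.card d * M * Real.sqrt (tail N s) * Real.sqrt (D N s) := by
      have hb' := abs_integral_inner_convect_le_of_norm_le (u := b s) hv hM hbs hPs
      rwa [gradNormSq_fourierTruncate] at hb'
    -- stretching: split `w = (w - P_N w) + P_N w` in the convecting slot
    have iS : Integrable (fun x => ⟪b s x, FunctionSpaces.Torus.convect (w s) (P N (w s)) x⟫_ℝ) volume :=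
      integrable_inner_convect_of_integrable_smul hs.2.2 hPs
    have iS2 : Integrable (fun x => ⟪b s x, FunctionSpaces.Torus.convect (P N (w s)) (P N (w s)) x⟫_ℝ) volume :=
      FunctionSpaces.Torus.integrable_inner_of_continuous hbint (hPs.convect hPs).continuous
    have hS1eq : (∫ x, ⟪b s x, FunctionSpaces.Torus.convect (w s) (P N (w s)) x⟫_ℝ) -
        ∫ x, ⟪b s x, FunctionSpaces.Torus.convect (P N (w s)) (P N (w s)) x⟫_ℝ =
        ∫ x, ⟪b s x, FunctionSpaces.Torus.convect (fun x => w s x - P N (w s) x) (P N (w s)) x⟫_ℝ := by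
      rw [← integral_sub iS iS2]
      refine integral_congr_ae (ae_of_all _ fun x => ?_)
      simp only [FunctionSpaces.Torus.convect, ← inner_sub_right, ← map_sub]
    have hS1 : |(∫ x, ⟪b s x, FunctionSpaces.Torus.convect (w s) (P N (w s)) x⟫_ℝ) -
        ∫ x, ⟪b s x, FunctionSpaces.Torus.convect (P N (w s)) (P N (w s)) x⟫_ℝ| ≤
        Fintype.card d * M * Real.sqrt (tail N s) * Real.sqrt (D N s) := by
      rw [hS1eq]
      have hb' := abs_integral_inner_convect_le_of_norm_le_left (u := b s) hv hM hbs hPs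
      rwa [gradNormSq_fourierTruncate] at hb'
    have hS2 : A * ∫ x, ⟪b s x, FunctionSpaces.Torus.convect (P N (w s)) (P N (w s)) x⟫_ℝ ≤ Λ s * E s := by
      refine (hps (P N (w s)) hPs hPdiv).trans ?_
      exact mul_le_mul_of_nonneg_left (FunctionSpaces.Torus.integral_norm_sq_fourierTruncate_le hs2 N) (hΛ0 s)
    -- assemble
    have hνD : 0 ≤ ν * D N s := mul_nonneg hν.le (hD_nn N s)
    have hA1 : A * ((∫ x, ⟪b s x, FunctionSpaces.Torus.convect (w s) (P N (w s)) x⟫_ℝ) -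
        ∫ x, ⟪b s x, FunctionSpaces.Torus.convect (P N (w s)) (P N (w s)) x⟫_ℝ) ≤
        |A| * (Fintype.card d * M * Real.sqrt (tail N s) * Real.sqrt (D N s)) := by
      refine (le_abs_self _).trans ?_
      rw [abs_mul]
      exact mul_le_mul_of_nonneg_left hS1 (abs_nonneg A)
    have hR' := le_abs_self (∫ x, ⟪w s x - P N (w s) x, FunctionSpaces.Torus.convect (b s) (P N (w s)) x⟫_ℝ)
    show F N s ≤ G N s + Λ s * E s
    simp only [hF, hG, hC]
    rw [h1]
    nlinarith [hR, hS1, hS2, hA1, hR', hνD, mul_nonneg (Real.sqrt_nonneg (tail N s)) (Real.sqrt_nonneg (D N s))]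
  -- ### the tail terms vanish in `L¹(0,T)`
  set Y : ℕ → ℝ := fun N =>
    C * (Real.sqrt (∫ s in Ioo 0 T, tail N s) * Real.sqrt ((∫⁻ s in Ioo 0 T, g s).toReal)) with hYdef
  have hY : ∀ N, ∫ s in Ioo 0 T, G N s ≤ Y N := by
    intro N
    calc ∫ s in Ioo 0 T, G N s = C * ∫ s in Ioo 0 T, Real.sqrt (tail N s) * Real.sqrt (D N s) :=
          integral_const_mul _ _
      _ ≤ C * (Real.sqrt (∫ s in Ioo 0 T, tail N s) * Real.sqrt (∫ s in Ioo 0 T, D N s)) :=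
          mul_le_mul_of_nonneg_left (SolenoidalFractalHomogenisation.LagrangianStep.DualityTools.integral_sqrt_mul_sqrt_le
            (htailint N) (hDint N).1
            (ae_of_all _ fun s => htail_nn N s) (ae_of_all _ fun s => hD_nn N s)) hC0
      _ ≤ Y N := by
          rw [hYdef]
          exact mul_le_mul_of_nonneg_left (mul_le_mul_of_nonneg_left (Real.sqrt_le_sqrt (hDint N).2)
            (Real.sqrt_nonneg _)) hC0
  have hY0 : Tendsto Y atTop (𝓝 0) := by
    have h1 := h.tendsto_integral_galerkin_tail
    have h2 : Tendsto (fun N => Real.sqrt (∫ s in Ioo 0 T, tail N s)) atTop (𝓝 0) := by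
      have := (Real.continuous_sqrt.tendsto 0).comp h1
      rwa [Real.sqrt_zero] at this
    have h3 := (h2.mul_const (Real.sqrt ((∫⁻ s in Ioo 0 T, g s).toReal))).const_mul C
    rw [zero_mul, mul_zero] at h3
    exact h3
  -- ### conclude at a.e. `t`
  have hFle' : ∀ᵐ t ∂(volume.restrict (Ioo 0 T)), ∀ N, F N t ≤ G N t + Λ t * E t := ae_all_iff.2 hFle
  filter_upwards [hId, h.ae_memLp_two, ae_restrict_mem measurableSet_Ioo] with t ht ht2 htI
  have hsub : Ioc 0 t ⊆ Ioo 0 T := Ioc_subset_Ioo_right htI.2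
  have hFt : ∀ N, IntegrableOn (F N) (Ioc 0 t) := fun N => (hFint N).mono_set hsub
  have hGt : ∀ N, IntegrableOn (G N) (Ioc 0 t) := fun N => (hGint N).mono_set hsub
  have hΛEt : IntegrableOn (fun s => Λ s * E s) (Ioc 0 t) := hΛE.mono_set hsub
  -- the bound for each `N`
  have hN : ∀ N, ∫ x, ⟪P N (w t) x, P N (w t) x⟫_ℝ ≤
      (∫ x, ‖w₀ x‖ ^ 2) + 2 * Y N + 2 * ∫ s in Ioc 0 t, Λ s * E s := by
    intro N
    have h0 : (∫ x, ⟪P N w₀ x, P N w₀ x⟫_ℝ) ≤ ∫ x, ‖w₀ x‖ ^ 2 := by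
      calc (∫ x, ⟪P N w₀ x, P N w₀ x⟫_ℝ) = ∫ x, ‖P N w₀ x‖ ^ 2 :=
            integral_congr_ae (ae_of_all _ fun x => real_inner_self_eq_norm_sq _)
        _ ≤ ∫ x, ‖w₀ x‖ ^ 2 := FunctionSpaces.Torus.integral_norm_sq_fourierTruncate_le hw₀ N
    have hle1 : ∫ s in Ioc 0 t, F N s ≤ ∫ s in Ioc 0 t, (G N s + Λ s * E s) :=
      integral_mono_ae (hFt N) ((hGt N).add hΛEt) (ae_restrict_of_ae_restrict_of_subset hsub (hFle N))
    have hle2 : ∫ s in Ioc 0 t, G N s ≤ ∫ s in Ioo 0 T, G N s :=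
      setIntegral_mono_set (hGint N) (ae_of_all _ fun s => hG_nn N s) hsub.eventuallyLE
    rw [ht N, integral_add (hGt N) hΛEt] at *
    nlinarith [hle1, hle2, hY N, h0]
  -- pass to the limit `N → ∞`
  have hEt : Tendsto (fun N => ∫ x, ⟪P N (w t) x, P N (w t) x⟫_ℝ) atTop (𝓝 (∫ x, ‖w t x‖ ^ 2)) :=
    tendsto_integral_inner_fourierTruncate_self ht2
  have hRt : Tendsto (fun N => (∫ x, ‖w₀ x‖ ^ 2) + 2 * Y N + 2 * ∫ s in Ioc 0 t, Λ s * E s) atTop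
      (𝓝 ((∫ x, ‖w₀ x‖ ^ 2) + 2 * 0 + 2 * ∫ s in Ioc 0 t, Λ s * E s)) :=
    (tendsto_const_nhds.add (hY0.const_mul 2)).add tendsto_const_nhds
  rw [mul_zero, add_zero] at hRt
  exact le_of_tendsto_of_tendsto' hEt hRt hN

/-- **ν-uniform energy growth for weak passive vectors (Grönwall form).** Under the hypotheses of
`ae_integral_norm_sq_le_add` (weak solution of the class `IsWeakPassiveVectorOn A`, `ν > 0`, bounded
carrier, `L²` weakly divergence-free datum, production bound `A ∫⟪b(s), (v·∇)v⟫ ≤ Λ(s) ∫‖v‖²` on smooth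
divergence-free fields with `Λ ≥ 0` continuous): for a.e. `t ∈ (0,T)`,
`∫‖w(t)‖² ≤ (∫‖w₀‖²) · exp (∫₀ᵗ 2Λ)` — Grönwall–Bellman (`Literature.Analysis.ODE.gronwall_integral_le_on`)
applied to the CONTINUOUS majorant `Ψ(t) = ∫‖w₀‖² + 2∫₀ᵗ Λ ∫‖w‖²`, which dominates `∫‖w(t)‖²` a.e.
[cite: MajdaBertozziCUP2002, §3.1.1 Prop. 3.1 (3.7) (energy growth by the velocity-gradient rate)] [cite: RobinsonRodrigoSadowski2016, §4.2 (4.20)] -/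
theorem ae_integral_norm_sq_le_mul_exp {A T ν : ℝ} {b w : ℝ → UnitAddTorus d → EuclideanSpace ℝ d}
    {w₀ : UnitAddTorus d → EuclideanSpace ℝ d}
    (h : IsWeakPassiveVectorOn A T ν b w₀ w) (hν : 0 < ν)
    (hw₀ : MemLp w₀ 2 volume) (hdiv₀ : FunctionSpaces.Torus.IsWeaklyDivFree w₀)
    (hb : MemLp (FunctionSpaces.Torus.stLift b) ∞ (volume.restrict (Ioo 0 T ×ˢ univ)))
    {Λ : ℝ → ℝ} (hΛc : Continuous Λ) (hΛ0 : ∀ s, 0 ≤ Λ s)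
    (hprod : ∀ᵐ s ∂(volume.restrict (Ioo 0 T)), ∀ v : UnitAddTorus d → EuclideanSpace ℝ d,
      FunctionSpaces.Torus.IsSmooth v → FunctionSpaces.Torus.IsDivFree v →
      A * ∫ x, ⟪b s x, FunctionSpaces.Torus.convect v v x⟫_ℝ ≤ Λ s * ∫ x, ‖v x‖ ^ 2) :
    ∀ᵐ t ∂(volume.restrict (Ioo 0 T)),
      ∫ x, ‖w t x‖ ^ 2 ≤ (∫ x, ‖w₀ x‖ ^ 2) * Real.exp (∫ s in (0:ℝ)..t, 2 * Λ s) := by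
  have hpre := ae_integral_norm_sq_le_add h hν hw₀ hdiv₀ hb hΛc hΛ0 hprod
  set E : ℝ → ℝ := fun s => ∫ x, ‖w s x‖ ^ 2 with hE
  set c : ℝ := ∫ x, ‖w₀ x‖ ^ 2 with hc
  have hc0 : 0 ≤ c := integral_nonneg fun x => sq_nonneg _
  have hE0 : ∀ s, 0 ≤ E s := fun s => integral_nonneg fun x => sq_nonneg _
  have hEint : IntegrableOn E (Ioo 0 T) := h.integrableOn_integral_norm_sq
  have hΛE : IntegrableOn (fun s => Λ s * E s) (Ioo 0 T) :=
    hEint.continuousOn_mul_of_subset hΛc.continuousOn isCompact_Icc measurableSet_Ioo Ioo_subset_Icc_self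
  -- the integrable density on `ℝ` and its continuous primitive
  set f : ℝ → ℝ := (Ioo 0 T).indicator fun s => 2 * (Λ s * E s) with hf
  have hfint : Integrable f volume := (integrable_indicator_iff measurableSet_Ioo).2 (hΛE.const_mul 2)
  have hf0 : ∀ s, 0 ≤ f s := fun s => by
    simp only [hf]
    refine Set.indicator_nonneg (fun s _ => ?_) s
    exact mul_nonneg zero_le_two (mul_nonneg (hΛ0 s) (hE0 s))
  set Ψ : ℝ → ℝ := fun t => c + ∫ s in (0:ℝ)..t, f s with hΨ
  have hΨc : Continuous Ψ :=
    continuous_const.add (intervalIntegral.continuous_primitive (fun a b => hfint.intervalIntegrable) 0)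
  have hΨ0 : ∀ t, 0 ≤ t → 0 ≤ Ψ t := fun t ht =>
    add_nonneg hc0 (intervalIntegral.integral_nonneg ht fun s _ => hf0 s)
  -- `E ≤ Ψ` a.e. on `(0,T)`
  have hEΨ : ∀ᵐ t ∂(volume.restrict (Ioo 0 T)), E t ≤ Ψ t := by
    filter_upwards [hpre, ae_restrict_mem measurableSet_Ioo] with t ht htI
    have hsub : Ioc 0 t ⊆ Ioo 0 T := Ioc_subset_Ioo_right htI.2
    have e : ∫ s in (0:ℝ)..t, f s = 2 * ∫ s in Ioc 0 t, Λ s * E s := by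
      rw [intervalIntegral.integral_of_le htI.1.le, ← integral_const_mul]
      refine setIntegral_congr_fun measurableSet_Ioc fun s hs => ?_
      simp only [hf, Set.indicator_of_mem (hsub hs)]
    show E t ≤ c + ∫ s in (0:ℝ)..t, f s
    rw [e]
    exact ht
  have hEΨ' : ∀ᵐ s ∂(volume : Measure ℝ), s ∈ Ioo 0 T → E s ≤ Ψ s := (ae_restrict_iff' measurableSet_Ioo).1 hEΨ
  -- the integral inequality for the continuous majorant
  have hle : ∀ t ∈ Icc 0 T, Ψ t ≤ c + ∫ s in (0:ℝ)..t, (2 * Λ s) * Ψ s := by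
    intro t ht
    have hcont : Continuous fun s => (2 * Λ s) * Ψ s := (continuous_const.mul hΛc).mul hΨc
    show c + ∫ s in (0:ℝ)..t, f s ≤ c + ∫ s in (0:ℝ)..t, (2 * Λ s) * Ψ s
    refine add_le_add le_rfl ?_
    rw [intervalIntegral.integral_of_le ht.1, intervalIntegral.integral_of_le ht.1]
    refine integral_mono_ae hfint.integrableOn (hcont.integrableOn_Icc.mono_set Ioc_subset_Icc_self) ?_
    filter_upwards [ae_restrict_mem measurableSet_Ioc, ae_restrict_of_ae hEΨ'] with s hs hs'
    by_cases hsT : s ∈ Ioo 0 T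
    · simp only [hf, Set.indicator_of_mem hsT]
      have := hs' hsT
      nlinarith [hΛ0 s, hE0 s]
    · simp only [hf, Set.indicator_of_notMem hsT]
      exact mul_nonneg (mul_nonneg zero_le_two (hΛ0 s)) (hΨ0 s hs.1.le)
  have hgr := Literature.Analysis.ODE.gronwall_integral_le_on (a := fun s => 2 * Λ s) (g := Ψ) (h := fun _ => c)
    (T := T) (continuous_const.mul hΛc) hΨc (fun s => mul_nonneg zero_le_two (hΛ0 s))
    (fun _ _ _ _ _ => le_rfl) hle
  filter_upwards [hEΨ, ae_restrict_mem measurableSet_Ioo] with t ht htI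
  exact ht.trans (hgr t ⟨htI.1.le, htI.2.le⟩)

end Summit.AnomalousDissipation.AnomalousDissipation.Theorems.SawtoothPulseCascade.K3NonlinearClosureLocalised

end
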